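import Literature.Analysis.Calculus.BCHProductLowOrder
import Literature.Analysis.SpecialFunctions.ExpFDeriv
import Literature.MathematicalPhysics.QuantumFieldTheory.Balaban1983to89.MatrixLog
import HarnessLib

/-!
# S2β · `hFlat` road, brick (G4) of UV3-NODE §57.8 (C)(2) — THE COUPLING LETTER: the MIXED SECOND DIFFERENCE of
# `F(A, a) := log(A·eᵃ·B)` in (context `A`, member `a`) is BILINEARLY small, `‖Δ_A Δ_a F‖ ≤ 256·‖A − A′‖·‖a − a′‖`, on the ball
# `‖A − 1‖, ‖A′ − 1‖, ‖a‖, ‖a′‖, ‖B − 1‖ ≤ 1∕20` (two nested one-variable Schwarz lemmas)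

Cell `ym3-torus` (rung R3 = continuum `SU(2)` Yang–Mills on the three-torus — NOT d = 4, NOT infinite volume, NOT a mass gap, NOT Clay).
Width seat «width 8» `ym3-torus-px8` (gen 21), FREE px helper on crux `stmt-QuantumFields-20520`, count-neutral, DEFINITION-FREE.

WHY (UV3-NODE §57.8 (C)(2)).  After the hybrid step (✓`…EmlMemberTransportMeanContext`) the logarithm of a plaquette word of averaged bonds is the mean over
INDEPENDENT member indices of the member words; the COUPLING to a bijection `j = j(i)` (so that consecutive member paths CONTINUE and every comb hairpin collapses)
changes the mean by `E_i E_j E_{i′}[Φ(i, j(i)) − Φ(i, j) − Φ(i′, j(i)) + Φ(i′, j)]` — a MIXED SECOND DIFFERENCE in (member of edge 1, member of edge 2).  This file bounds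
such a difference by the product of the two increments, so that the coupling costs (fluctuation of edge 1) × (size of edge 2) = chargeable × small, never a bare power of
the word size.  The context slot `A` need not be unitary (the Schwarz interpolation `A′ + s(A − A′)` leaves the group): only `‖A − 1‖` small is used.

* §1 `norm_mlog_le_one_of_le_half` (`‖X − 1‖ ≤ ½ ⟹ ‖log X‖ ≤ 1`), `norm_triple_sub_one_le` (size of `A·eᵃ·B − 1` on the ball: `≤ e^{0.4} − 1 < ½`).
* §2 ★ `norm_mlog_ctx_sub_le` — ONE Schwarz step: `‖log(A·E·B) − log(A′·E·B)‖ ≤ (2∕R)·1` along `s ↦ A′ + s(A − A′)`, i.e. `≤ 16·‖A − A′‖` (radius `R = (1∕8)∕‖A − A′‖`).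
* §3 ★★ `norm_mixedDiff_mlog_le` — THE COUPLING LETTER: `‖F(A,a) − F(A,a′) − F(A′,a) + F(A′,a′)‖ ≤ 256·‖A − A′‖·‖a − a′‖`, `F(A,a) = log(A·exp a·B)`.

HONEST SCOPE.  Complex-analytic bookkeeping (Mathlib's Schwarz lemma `Complex.dist_le_div_mul_dist_of_mapsTo_ball`, twice) over the tree's series logarithm; constants `1∕20`,
`1∕8`, `16`, `256` are admissible witnesses, not optimal; nothing of Bałaban's analysis; the coupling identity itself (finite averaging over a bijection), the nonabelian KEY
LEMMA, the recursion, `hFlat`, TUBE-REG∘, GAP♯∘, S2β, crux 20520 and `YM3TorusSU2` are NOT proved; no registered stub is closed; the Yang–Mills mass gap is NOT proved.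
References: W. Rossmann, *Lie Groups* (OUP 2002) §1.3 Thm 1 and remark after (5) [Rossmann2002]; T. Bałaban, CMP **109** (1987) [Balaban1987RG1] ((0.4)–(0.8) p.253).
-/

set_option autoImplicit false

noncomputable section

open NormedSpace Metric Set
open scoped Topology

namespace Summit.QuantumFields.YangMills.Theorems.FluctuationComparisonRegPrIntLS2BetaMlogMixedDifference

open Literature.Analysis.Calculus.BCH (norm_mul_sub_one_le_of_le)
open Literature.Analysis.Calculus.ExpDifferential (norm_exp_sub_one_le_exp_norm_sub_one)
open Literature.Analysis.Complex (logOnePlus differentiableOn_logOnePlus_comp)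
open Literature.Analysis.SpecialFunctions (ExpFDeriv.differentiable_exp)
open Literature.MathematicalPhysics.QuantumFieldTheory.Balaban1983to89.MatrixLog (mlog mlog_def norm_mlog_le_div)

variable {𝔸 : Type*} [NormedRing 𝔸] [NormedAlgebra ℂ 𝔸] [CompleteSpace 𝔸] [NormOneClass 𝔸]

/-! ## §1 Sizes on the ball -/

omit [NormOneClass 𝔸] in
/-- `‖X − 1‖ ≤ ½ ⟹ ‖log X‖ ≤ 1` ((26): `‖log X‖ ≤ ‖X − 1‖∕(1 − ‖X − 1‖)`). [folklore] -/
theorem norm_mlog_le_one_of_le_half {X : 𝔸} (hX : ‖X - 1‖ ≤ 1 / 2) : ‖mlog X‖ ≤ 1 := by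
  refine (norm_mlog_le_div (hX.trans_lt (by norm_num))).trans ?_
  rw [div_le_one (by linarith)]; linarith

omit [NormedAlgebra ℂ 𝔸] [CompleteSpace 𝔸] [NormOneClass 𝔸] in
/-- `‖x − 1‖ ≤ e^{‖x−1‖} − 1` (`y ≤ e^y − 1` for `y ≥ 0`). [folklore] -/
theorem norm_sub_one_le_exp_sub_one (x : 𝔸) : ‖x - 1‖ ≤ Real.exp ‖x - 1‖ - 1 := by
  linarith [Real.add_one_le_exp ‖x - 1‖]

omit [NormOneClass 𝔸] in
/-- **SIZE OF THE WORD ON THE BALL**: `‖A − 1‖ ≤ α`, `‖a‖ ≤ α`, `‖B − 1‖ ≤ β` ⟹ `‖A·eᵃ·B − 1‖ ≤ e^{2α+β} − 1`. [folklore] -/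
theorem norm_triple_sub_one_le {A a B : 𝔸} {α β : ℝ} (hA : ‖A - 1‖ ≤ α) (ha : ‖a‖ ≤ α) (hB : ‖B - 1‖ ≤ β) :
    ‖A * exp a * B - 1‖ ≤ Real.exp (2 * α + β) - 1 := by
  have h1 : ‖A - 1‖ ≤ Real.exp α - 1 := (norm_sub_one_le_exp_sub_one A).trans (by gcongr)
  have h2 : ‖exp a - 1‖ ≤ Real.exp α - 1 := (norm_exp_sub_one_le_exp_norm_sub_one a).trans (by gcongr)
  have h3 : ‖B - 1‖ ≤ Real.exp β - 1 := (norm_sub_one_le_exp_sub_one B).trans (by gcongr)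
  have h12 := norm_mul_sub_one_le_of_le h1 h2
  have h := norm_mul_sub_one_le_of_le h12 h3
  calc ‖A * exp a * B - 1‖ ≤ Real.exp (α + α + β) - 1 := h
    _ = Real.exp (2 * α + β) - 1 := by ring_nf

/-- Numerics: `e^{2/5} − 1 ≤ ½` (Taylor to order 3 with Mathlib's remainder: `1 + 0.4 + 0.08 + 0.0143 ≤ 1.5`). [folklore] -/
theorem exp_two_fifths_sub_one_le_half : Real.exp (2 / 5) - 1 ≤ 1 / 2 := by
  have h := Real.exp_bound' (x := (2 / 5 : ℝ)) (by norm_num) (by norm_num) (n := 3) (by norm_num)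
  simp only [Finset.sum_range_succ, Finset.sum_range_zero, Nat.factorial, Nat.cast_ofNat] at h
  norm_num at h
  linarith

/-! ## §2 One Schwarz step: the context difference at a fixed member -/

omit [NormOneClass 𝔸] in
/-- ★ **CONTEXT DIFFERENCE, ONE SCHWARZ STEP**: for `‖A − 1‖, ‖A′ − 1‖, ‖B − 1‖ ≤ 1∕20` and any `E` with `‖E − 1‖ ≤ e^{7∕40} − 1` (e.g. `E = eᵃ`, `‖a‖ ≤ 7∕40`):
`‖log(A·E·B) − log(A′·E·B)‖ ≤ 16·‖A − A′‖` — Schwarz along `s ↦ A′ + s(A − A′)` on the disc `|s| < (1∕8)∕‖A − A′‖`, where the word stays within `½` of `1` and `log` is bounded by `1`.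
[cite: Rossmann2002, §1.3 Theorem 1, remark after (5)] -/
theorem norm_mlog_ctx_sub_le {A A' E B : 𝔸} (hA : ‖A - 1‖ ≤ 1 / 20) (hA' : ‖A' - 1‖ ≤ 1 / 20) (hE : ‖E - 1‖ ≤ Real.exp (7 / 40) - 1)
    (hB : ‖B - 1‖ ≤ 1 / 20) :
    ‖mlog (A * E * B) - mlog (A' * E * B)‖ ≤ 16 * ‖A - A'‖ := by
  rcases eq_or_ne A A' with rfl | hne
  · simp
  have hd0 : 0 < ‖A - A'‖ := norm_pos_iff.mpr (sub_ne_zero.mpr hne)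
  have hdle : ‖A - A'‖ ≤ 1 / 10 := by
    calc ‖A - A'‖ = ‖(A - 1) - (A' - 1)‖ := by rw [sub_sub_sub_cancel_right]
      _ ≤ ‖A - 1‖ + ‖A' - 1‖ := norm_sub_le _ _
      _ ≤ 1 / 10 := by linarith
  set R : ℝ := (1 / 8) / ‖A - A'‖ with hR
  have hR1 : 1 < R := by rw [hR, lt_div_iff₀ hd0]; linarith
  set f : ℂ → 𝔸 := fun s => mlog ((A' + s • (A - A')) * E * B) with hf
  -- on the disc the context stays within 1/20 + 1/8 of 1
  have hctx : ∀ s ∈ ball (0 : ℂ) R, ‖(A' + s • (A - A')) - 1‖ ≤ 1 / 20 + 1 / 8 := by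
    intro s hs
    rw [mem_ball_zero_iff] at hs
    have hsle : ‖s‖ * ‖A - A'‖ ≤ 1 / 8 := by
      have := mul_le_mul_of_nonneg_right hs.le hd0.le
      rw [hR, div_mul_cancel₀ _ hd0.ne'] at this; exact this
    calc ‖A' + s • (A - A') - 1‖ = ‖(A' - 1) + s • (A - A')‖ := by abel_nf
      _ ≤ ‖A' - 1‖ + ‖s • (A - A')‖ := norm_add_le _ _
      _ ≤ 1 / 20 + 1 / 8 := by rw [norm_smul]; linarith
  have hword : ∀ s ∈ ball (0 : ℂ) R, ‖(A' + s • (A - A')) * E * B - 1‖ ≤ 1 / 2 := by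
    intro s hs
    have h1 : ‖(A' + s • (A - A')) - 1‖ ≤ Real.exp (1 / 20 + 1 / 8) - 1 :=
      (hctx s hs).trans (by linarith [Real.add_one_le_exp (1 / 20 + 1 / 8 : ℝ)])
    have h3 : ‖B - 1‖ ≤ Real.exp (1 / 20) - 1 := hB.trans (by linarith [Real.add_one_le_exp (1 / 20 : ℝ)])
    have h := norm_mul_sub_one_le_of_le (norm_mul_sub_one_le_of_le h1 hE) h3
    refine h.trans ?_
    have : Real.exp (1 / 20 + 1 / 8 + 7 / 40 + 1 / 20) ≤ Real.exp (2 / 5) := Real.exp_le_exp.mpr (by norm_num)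
    linarith [exp_two_fifths_sub_one_le_half]
  have hlt : ∀ s ∈ ball (0 : ℂ) R, ‖(A' + s • (A - A')) * E * B - 1‖ < 1 := fun s hs => (hword s hs).trans_lt (by norm_num)
  have hdiff : DifferentiableOn ℂ f (ball (0 : ℂ) R) := by
    have hu : Differentiable ℂ fun s : ℂ => (A' + s • (A - A')) * E * B - 1 :=
      ((((differentiable_id.smul_const (A - A')).const_add A').mul_const E).mul_const B).sub_const 1
    have h := differentiableOn_logOnePlus_comp hu.differentiableOn hlt
    refine h.congr fun s _ => ?_
    simp only [hf, mlog_def]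
  have hmaps : MapsTo f (ball (0 : ℂ) R) (closedBall (f 0) 2) := by
    intro s hs
    rw [mem_closedBall, dist_eq_norm]
    have h0 : (0 : ℂ) ∈ ball (0 : ℂ) R := mem_ball_self (by linarith)
    calc ‖f s - f 0‖ ≤ ‖f s‖ + ‖f 0‖ := norm_sub_le _ _
      _ ≤ 1 + 1 := add_le_add (norm_mlog_le_one_of_le_half (hword s hs)) (norm_mlog_le_one_of_le_half (hword 0 h0))
      _ = 2 := by norm_num
  have h1 : (1 : ℂ) ∈ ball (0 : ℂ) R := by simpa using hR1
  have hS := Complex.dist_le_div_mul_dist_of_mapsTo_ball hdiff hmaps h1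
  rw [dist_eq_norm, dist_zero_right, norm_one, mul_one] at hS
  have hf1 : f 1 = mlog (A * E * B) := by simp [hf]
  have hf0 : f 0 = mlog (A' * E * B) := by simp [hf]
  rw [hf1, hf0] at hS
  refine hS.trans (le_of_eq ?_)
  rw [hR, div_div_eq_mul_div]; ring

/-! ## §3 The coupling letter: the mixed second difference -/

/-- ★★ **THE COUPLING LETTER (mixed second difference of `log(A·eᵃ·B)`)**: for `‖A − 1‖, ‖A′ − 1‖, ‖a‖, ‖a′‖, ‖B − 1‖ ≤ 1∕20`,
`‖log(A·eᵃ·B) − log(A·e^{a′}·B) − log(A′·eᵃ·B) + log(A′·e^{a′}·B)‖ ≤ 256·‖A − A′‖·‖a − a′‖` — Schwarz along `t ↦ a′ + t(a − a′)` (disc `|t| < (1∕8)∕‖a − a′‖`) applied to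
the context difference `t ↦ log(A·e^{a_t}·B) − log(A′·e^{a_t}·B)`, which §2 bounds by `16‖A − A′‖` uniformly on the disc. USE (§57.8 (C)(2)): with `A − A′` = the fluctuation of
one edge's member (chargeable) and `a − a′` = two members of the next edge (≤ twice its size, small), the change of the word's mean logarithm under COUPLING of the two
edges' indices is ≤ (small) × (mean fluctuation). [cite: Rossmann2002, §1.3 Theorem 1, remark after (5)] -/
theorem norm_mixedDiff_mlog_le {A A' a a' B : 𝔸} (hA : ‖A - 1‖ ≤ 1 / 20) (hA' : ‖A' - 1‖ ≤ 1 / 20) (ha : ‖a‖ ≤ 1 / 20) (ha' : ‖a'‖ ≤ 1 / 20)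
    (hB : ‖B - 1‖ ≤ 1 / 20) :
    ‖mlog (A * exp a * B) - mlog (A * exp a' * B) - mlog (A' * exp a * B) + mlog (A' * exp a' * B)‖ ≤ 256 * ‖A - A'‖ * ‖a - a'‖ := by
  rcases eq_or_ne a a' with rfl | hne
  · simp
  have hd0 : 0 < ‖a - a'‖ := norm_pos_iff.mpr (sub_ne_zero.mpr hne)
  have hdle : ‖a - a'‖ ≤ 1 / 10 := (norm_sub_le _ _).trans (by linarith)
  set R : ℝ := (1 / 8) / ‖a - a'‖ with hR
  have hR1 : 1 < R := by rw [hR, lt_div_iff₀ hd0]; linarith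
  -- the context difference along the member segment
  set g : ℂ → 𝔸 := fun t => mlog (A * exp (a' + t • (a - a')) * B) - mlog (A' * exp (a' + t • (a - a')) * B) with hg
  have hmem : ∀ t ∈ ball (0 : ℂ) R, ‖a' + t • (a - a')‖ ≤ 7 / 40 := by
    intro t ht
    rw [mem_ball_zero_iff] at ht
    have htle : ‖t‖ * ‖a - a'‖ ≤ 1 / 8 := by
      have := mul_le_mul_of_nonneg_right ht.le hd0.le
      rw [hR, div_mul_cancel₀ _ hd0.ne'] at this; exact this
    calc ‖a' + t • (a - a')‖ ≤ ‖a'‖ + ‖t • (a - a')‖ := norm_add_le _ _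
      _ ≤ 7 / 40 := by rw [norm_smul]; linarith
  have hE : ∀ t ∈ ball (0 : ℂ) R, ‖exp (a' + t • (a - a')) - 1‖ ≤ Real.exp (7 / 40) - 1 := fun t ht =>
    (norm_exp_sub_one_le_exp_norm_sub_one _).trans (by gcongr; exact hmem t ht)
  -- §2 uniformly on the disc: ‖g t‖ ≤ 16‖A − A′‖
  have hgle : ∀ t ∈ ball (0 : ℂ) R, ‖g t‖ ≤ 16 * ‖A - A'‖ := fun t ht => norm_mlog_ctx_sub_le hA hA' (hE t ht) hB
  -- the words stay within ½ of 1, so `g` is differentiable on the disc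
  have hwordA : ∀ {C : 𝔸}, ‖C - 1‖ ≤ 1 / 20 → ∀ t ∈ ball (0 : ℂ) R, ‖C * exp (a' + t • (a - a')) * B - 1‖ < 1 := by
    intro C hC t ht
    have h := norm_triple_sub_one_le (α := 7 / 40) (β := 1 / 20) (hC.trans (by norm_num)) (hmem t ht) hB
    refine h.trans_lt ?_
    have : Real.exp (2 * (7 / 40) + 1 / 20) = Real.exp (2 / 5) := by norm_num
    linarith [exp_two_fifths_sub_one_le_half]
  have haff : Differentiable ℂ fun t : ℂ => a' + t • (a - a') := (differentiable_id.smul_const (a - a')).const_add a'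
  have hexp : Differentiable ℂ fun t : ℂ => exp (a' + t • (a - a')) := fun t =>
    (ExpFDeriv.differentiable_exp ℂ (𝔸 := 𝔸) _).comp t (haff t)
  have hdiffC : ∀ {C : 𝔸}, ‖C - 1‖ ≤ 1 / 20 → DifferentiableOn ℂ (fun t : ℂ => mlog (C * exp (a' + t • (a - a')) * B)) (ball (0 : ℂ) R) := by
    intro C hC
    have hu : Differentiable ℂ fun t : ℂ => C * exp (a' + t • (a - a')) * B - 1 := ((hexp.const_mul C).mul_const B).sub_const 1
    have h := differentiableOn_logOnePlus_comp hu.differentiableOn (hwordA hC)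
    refine h.congr fun t _ => ?_
    simp only [mlog_def]
  have hdiff : DifferentiableOn ℂ g (ball (0 : ℂ) R) := (hdiffC hA).sub (hdiffC hA')
  have hmaps : MapsTo g (ball (0 : ℂ) R) (closedBall (g 0) (32 * ‖A - A'‖)) := by
    intro t ht
    rw [mem_closedBall, dist_eq_norm]
    have h0 : (0 : ℂ) ∈ ball (0 : ℂ) R := mem_ball_self (by linarith)
    calc ‖g t - g 0‖ ≤ ‖g t‖ + ‖g 0‖ := norm_sub_le _ _
      _ ≤ 16 * ‖A - A'‖ + 16 * ‖A - A'‖ := add_le_add (hgle t ht) (hgle 0 h0)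
      _ = 32 * ‖A - A'‖ := by ring
  have h1 : (1 : ℂ) ∈ ball (0 : ℂ) R := by simpa using hR1
  have hS := Complex.dist_le_div_mul_dist_of_mapsTo_ball hdiff hmaps h1
  rw [dist_eq_norm, dist_zero_right, norm_one, mul_one] at hS
  have hg1 : g 1 = mlog (A * exp a * B) - mlog (A' * exp a * B) := by simp [hg]
  have hg0 : g 0 = mlog (A * exp a' * B) - mlog (A' * exp a' * B) := by simp [hg]
  rw [hg1, hg0] at hS
  have e : mlog (A * exp a * B) - mlog (A * exp a' * B) - mlog (A' * exp a * B) + mlog (A' * exp a' * B) =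
      (mlog (A * exp a * B) - mlog (A' * exp a * B)) - (mlog (A * exp a' * B) - mlog (A' * exp a' * B)) := by abel
  rw [e]
  refine hS.trans (le_of_eq ?_)
  rw [hR, div_div_eq_mul_div]; ring

end Summit.QuantumFields.YangMills.Theorems.FluctuationComparisonRegPrIntLS2BetaMlogMixedDifference

end
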